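import Summits.HodgeConjecture.HodgeConjecture.Theorems.F0P2oD7alphaMemDockOfRowsT                    -- ★ p840848: brings ★ `F0P2oD7alphaMemDockOfRows.mem_packFin_of_rows` (MEM at the rows) and the kit vocabulary
import Summits.HodgeConjecture.HodgeConjecture.Theorems.F0P2oD7alphaMemDockStatementW1              -- ROAD W (c): the W1 node `StubD7αMemDockPerMeasureTW1`
import Summits.HodgeConjecture.HodgeConjecture.Theorems.F0P2oCharIdentityCompletionUniqueTestW1     -- ROAD W (d): the W1 junction at `Δ°` from (D-b)ᵀˢ-W1 at `Δ` (+ (B1′) `CharIdentityOnTestFunctionsFormSign`, LH7 `formSignAt`)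
import HarnessLib

/-!
# Crux `H413`, programme P2 — (D7α-J) PRODUCER, TEST EDITION, SIGNED ROWS, **WEIGHT-ONE AUTOMORPHIC LOCUS («W1»)**: the W1 node `StubD7αMemDockPerMeasureTW1` from record data
# SIGNED at the factor of record, with (D-b)ᵀˢ-W1 in place of (D-b)ᵀˢ (ROAD W item (e); F0P2-ref1 (g10) r363∕r364)

Cell `hodgecm-mathlib` (D-0151), FLOOR 0, crux item H413 = `stmt-HodgeConjecture-24833`, route of record `HCCMUnconditional`; programme P2, fallback road PKΠ
`Cruxes/H413/Lines/F0_P2PKPiRung4.lean`.  ROAD W of the LH10 line (LH10-p02 (g0) 2026-09-02T03:19:42Z architectural ask; F0P2-p06 (g14) census 03:24:26Z; F0P2-ref1 r363 (2)(3),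
r364 (3) «cut HOME-first, statement-first; FILE only on LEAD + director «v1.16 W1 GO»»).  Seat F0P2-p06 (g14).  Helper file: THEOREMS ONLY (no definition, no named fact, no
instance declaration or attribute, no notation, no `sorry`); `--supports stmt-HodgeConjecture-24833 --as helper`; Lines-free.  HONEST LABEL: HC_CM is proved only modulo the
printed citations (2 remaining named inputs hLiu418 24832, h413 24833) until rung 0 closes; this file discharges none of them.

WHAT — the W1 twin of ★ p848433 `F0P2oD7alphaMemDockOfRowsSigned.stubD7αMemDockPerMeasureT_of_rowsSigned`.  Hypotheses H₁ `𝔇`, H₂ `h` (the fourteen rows) VERBATIM; `hrecSW1` = ★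
B2's `hrecS` TEXT with EXACTLY ONE token changed: (H₈ᵀˢ) `piSCompletion_isThetaTypeAtCMTestSigned` ↦ `piSCompletion_isThetaTypeAtCMTestSignedW1` (ROAD W (b), LH10: the SIGNED
(D-b) letter with `HasWeight L μ 1 →` `IsAutomorphicOneChar … χf →` inserted — payable IN-HOUSE on that locus by LH10's theta-engine road); conclusion the W1 node ROAD W (c)
`F0P2oD7alphaMemDockStatementW1.StubD7αMemDockPerMeasureTW1` (DOCKᵀ ↦ DOCKᵀ-W1, SHAPE∕MEM unchanged).  Proof (assembly + the B1 sign transport, as ★ B2 but the node assembled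
here since ★ producerᵀ concludes the unrestricted node): per frame `Δ° := fun v => (Δ v).constMul ↑(formSignAt L c H v)`; DOCKᵀ-W1 at `Δ°` by ROAD W (d)
`cmThetaDockingClausesTestW1_constMul_formSignAt_of_thetaWitnessSignedW1` fed (H₇) and (H₈ᵀˢ-W1); SHAPE at `Δ°` from the signed SHAPE at `Δ` (★ `LocalAPacket.charIdentityAtTest_constMul_iff`
along ★ `clauseSign_eq_intCast_formSignAt`); MEM_μ = ★ `mem_packFin_of_rows` (the packet IS the kit's); Haar data passed through.
[cite: Rogawski1990, §13.1 Prop. 13.1.3 (d), Prop. 13.1.4 p. 199; §4.9 Prop. 4.9.1 (a) p. 55; §14.6 p. 242] [cite: GelbartRogawski1991, Lem. 5.1.2 p. 466; Thm. 5.1.1 p. 465]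
[cite: Liu2021, Def. 4.11, Prop. 4.13] [cite: LanglandsShelstad1987, §1]
-/

set_option autoImplicit false
-- the mandated namespace repeats `HodgeConjecture.HodgeConjecture`, as in every `Theorems/*.lean` of this sub-problem
set_option linter.dupNamespace false

noncomputable section

open NumberField IsDedekindDomain MeasureTheory
open scoped Matrix ComplexOrder

namespace Summit.HodgeConjecture.HodgeConjecture.Cruxes.H413.F0P2oD7alphaMemDockOfRowsSignedW1

open Literature.NumberTheory.Rogawski1990 Literature.NumberTheory.GaloisRepresentations
open Literature.NumberTheory.Automorphic Literature.NumberTheory.Automorphic.UnitaryGroup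
open Literature.NumberTheory.Automorphic.UnitaryGroup.CotangentForms
open Literature.RepresentationTheory.BorelWallach2000 Literature.RepresentationTheory.KonnoKonno2007
open Summit.HodgeConjecture.HodgeConjecture.Cruxes.H413.F0P3InnerFormClassificationV6 (Gp Places)
open Summit.HodgeConjecture.HodgeConjecture.Cruxes.H413.F0P3KitOfRecord (FrameData kitFamilyOfRecord)
open Summit.HodgeConjecture.HodgeConjecture.Cruxes.H413.F0P3XiArchPacketOfRecord (JInfNoDegOne DsInfNoDegOne)
open Summit.HodgeConjecture.HodgeConjecture.Cruxes.H413.F0P2oD7alphaMemDockOfRows (mem_packFin_of_rows)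

/-! ## §1 THE W1 NODE FROM THE ROWS AND RECORD DATA SIGNED AT THE FACTOR OF RECORD -/

section PerMeasureSW1

variable
  (𝔇 : ∀ (L : Type) [Field L] [NumberField L] [IsCMField L] (ι : L →+* ℂ) (H : Matrix (Fin 3) (Fin 3) L) (T : GL (Fin 3) ℂ)
    (hT : (T : Matrix (Fin 3) (Fin 3) ℂ)ᴴ * H.map ι * (T : Matrix (Fin 3) (Fin 3) ℂ) = Literature.Geometry.ComplexHyperbolic.BallModel.J),
    (∀ τ' : L →+* ℂ, InfinitePlace.mk τ' ≠ InfinitePlace.mk ι → (H.map τ').PosDef) →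
    2 ≤ Module.finrank ℚ ↥(maximalRealSubfield L) →
    ∀ (μ : Measure (Gp L H).automorphicQuotient) [(Gp L H).IsAutomorphicMeasure μ] (μω : HeckeCharacter L) (_hμu : μω.IsUnitary),
    (∀ x : Literature.NumberTheory.GaloisRepresentations.ideleGroup ↥(maximalRealSubfield L),
      μω (AdeleRing.ideleBaseChange (↥(maximalRealSubfield L)) L x) = quadraticHeckeCharCM L x) → FrameData L H ι T hT μ)
  (h : ∀ (L : Type) [Field L] [NumberField L] [IsCMField L] (ι : L →+* ℂ) (H : Matrix (Fin 3) (Fin 3) L) (T : GL (Fin 3) ℂ)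
    (hT : (T : Matrix (Fin 3) (Fin 3) ℂ)ᴴ * H.map ι * (T : Matrix (Fin 3) (Fin 3) ℂ) = Literature.Geometry.ComplexHyperbolic.BallModel.J)
    (hdef : ∀ τ' : L →+* ℂ, InfinitePlace.mk τ' ≠ InfinitePlace.mk ι → (H.map τ').PosDef) (h2 : 2 ≤ Module.finrank ℚ ↥(maximalRealSubfield L))
    (μ : Measure (Gp L H).automorphicQuotient) [(Gp L H).IsAutomorphicMeasure μ] (μω : HeckeCharacter L) (hμu : μω.IsUnitary)
    (hμω : ∀ x : Literature.NumberTheory.GaloisRepresentations.ideleGroup ↥(maximalRealSubfield L),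
      μω (AdeleRing.ideleBaseChange (↥(maximalRealSubfield L)) L x) = quadraticHeckeCharCM L x),
    ∃ S₀ : Finset (Places L),
    F0P3InnerFormClassificationV8.ClassificationKit.SpecPkg (kitFamilyOfRecord 𝔇 L ι H T hT hdef h2 μ μω hμu hμω) S₀ ∧
    (kitFamilyOfRecord 𝔇 L ι H T hT hdef h2 μ μω hμu hμω).TraceIdentity ∧
    F0P3InnerFormClassificationV8.ClassificationKit.FactorisationCls (kitFamilyOfRecord 𝔇 L ι H T hT hdef h2 μ μω hμu hμω) S₀ ∧
    (kitFamilyOfRecord 𝔇 L ι H T hT hdef h2 μ μω hμu hμω).SpectralSideGp ∧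
    F0P3InnerFormClassificationV8.ClassificationKit.HatBounded (kitFamilyOfRecord 𝔇 L ι H T hT hdef h2 μ μω hμu hμω) S₀ ∧
    F0P3InnerFormClassificationV8.ClassificationKit.UnrStarAlgebra (kitFamilyOfRecord 𝔇 L ι H T hT hdef h2 μ μω hμu hμω) S₀ ∧
    (kitFamilyOfRecord 𝔇 L ι H T hT hdef h2 μ μω hμu hμω).LinIndepS ∧
    F0P3InnerFormClassificationV8.ClassificationKit.UnitaryPacket (kitFamilyOfRecord 𝔇 L ι H T hT hdef h2 μ μω hμu hμω) S₀ ∧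
    (kitFamilyOfRecord 𝔇 L ι H T hT hdef h2 μ μω hμu hμω).Routing ∧
    JInfNoDegOne (𝔇 L ι H T hT hdef h2 μ μω hμu hμω).jInf ∧ DsInfNoDegOne (𝔇 L ι H T hT hdef h2 μ μω hμu hμω).dsInf ∧
    (kitFamilyOfRecord 𝔇 L ι H T hT hdef h2 μ μω hμu hμω).XiFamilyFin μω hμu ∧
    (kitFamilyOfRecord 𝔇 L ι H T hT hdef h2 μ μω hμu hμω).XiUnram ∧
    (kitFamilyOfRecord 𝔇 L ι H T hT hdef h2 μ μω hμu hμω).EvpConvention)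

include h in
open scoped Classical in
/-- **THE W1 NODE `StubD7αMemDockPerMeasureTW1` FROM THE ROWS AND RECORD DATA SIGNED AT THE FACTOR OF RECORD, WITH (D-b)ᵀˢ-W1.**  Hypotheses as ★ B2
`stubD7αMemDockPerMeasureT_of_rowsSigned` with (H₈ᵀˢ) ↦ (H₈ᵀˢ-W1) `piSCompletion_isThetaTypeAtCMTestSignedW1` BY NAME; conclusion the W1 node BY NAME.  Print's dock ∕ (D-b)
[Rogawski1990 Prop. 13.1.3 (d), 13.1.4; GelbartRogawski1991 Lem. 5.1.2, Thm. 5.1.1] RESTRICTED to the weight-one automorphic locus `(HasWeight μ 1, IsAutomorphicOneChar χf)` —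
the only locus HC_CM instantiates (★ `pkPi_of_tokens` :208–:221 ∕ skeleton :936).
[cite: Rogawski1990, §13.1 Prop. 13.1.3 (d), Prop. 13.1.4 p. 199; §4.9 Prop. 4.9.1 (a) p. 55; §14.6 p. 242] [cite: GelbartRogawski1991, Lem. 5.1.2 p. 466; Thm. 5.1.1 p. 465]
[cite: Liu2021, Def. 4.11, Prop. 4.13] -/
theorem stubD7αMemDockPerMeasureTW1_of_rowsSigned
  (hrecSW1 : ∀ (L : Type) [Field L] [NumberField L] [IsCMField L] (ι : L →+* ℂ) (H : Matrix (Fin 3) (Fin 3) L) (T : GL (Fin 3) ℂ)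
    (hT : (T : Matrix (Fin 3) (Fin 3) ℂ)ᴴ * H.map ι * (T : Matrix (Fin 3) (Fin 3) ℂ) = Literature.Geometry.ComplexHyperbolic.BallModel.J)
    (hdef : ∀ τ' : L →+* ℂ, InfinitePlace.mk τ' ≠ InfinitePlace.mk ι → (H.map τ').PosDef) (h2 : 2 ≤ Module.finrank ℚ ↥(maximalRealSubfield L))
    (μω : HeckeCharacter L) (hμu : μω.IsUnitary)
    (hμω : ∀ x : Literature.NumberTheory.GaloisRepresentations.ideleGroup ↥(maximalRealSubfield L), μω (AdeleRing.ideleBaseChange (↥(maximalRealSubfield L)) L x) = quadraticHeckeCharCM L x)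
    (μ : Measure (adelicGroupData (↥(maximalRealSubfield L)) L (IsCMField.complexConj L) 3 H).automorphicQuotient) [(adelicGroupData (↥(maximalRealSubfield L)) L (IsCMField.complexConj L) 3 H).IsAutomorphicMeasure μ],
    letI : ∀ v : HeightOneSpectrum (𝓞 ↥(maximalRealSubfield L)), MeasurableSpace ((cmDatum L 3 H).Local v) := fun _ => borel _
    letI : ∀ v : HeightOneSpectrum (𝓞 ↥(maximalRealSubfield L)),
        MeasurableSpace ((cmDatum L 2 (Matrix.of fun i j : Fin 2 => if i.val + j.val + 1 = 2 then (1 : L) else 0)).Local v ×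
          (cmDatum L 1 (Matrix.of fun i j : Fin 1 => if i.val + j.val + 1 = 1 then (1 : L) else 0)).Local v) := fun _ => borel _
    letI : ∀ (v : HeightOneSpectrum (𝓞 ↥(maximalRealSubfield L)))
        (a : ((cmDatum L 2 (Matrix.of fun i j : Fin 2 => if i.val + j.val + 1 = 2 then (1 : L) else 0)).Local v ×
          (cmDatum L 1 (Matrix.of fun i j : Fin 1 => if i.val + j.val + 1 = 1 then (1 : L) else 0)).Local v)),
        MeasurableSpace (((cmDatum L 2 (Matrix.of fun i j : Fin 2 => if i.val + j.val + 1 = 2 then (1 : L) else 0)).Local v ×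
            (cmDatum L 1 (Matrix.of fun i j : Fin 1 => if i.val + j.val + 1 = 1 then (1 : L) else 0)).Local v) ⧸
          Subgroup.centralizer ({a} : Set ((cmDatum L 2 (Matrix.of fun i j : Fin 2 => if i.val + j.val + 1 = 2 then (1 : L) else 0)).Local v ×
            (cmDatum L 1 (Matrix.of fun i j : Fin 1 => if i.val + j.val + 1 = 1 then (1 : L) else 0)).Local v))) := fun _ _ => borel _
    letI : ∀ (v : HeightOneSpectrum (𝓞 ↥(maximalRealSubfield L))) (γ : (cmDatum L 3 H).Local v),
        MeasurableSpace ((cmDatum L 3 H).Local v ⧸ Subgroup.centralizer ({γ} : Set ((cmDatum L 3 H).Local v))) := fun _ _ => borel _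
    letI : ∀ v : HeightOneSpectrum (𝓞 ↥(maximalRealSubfield L)), MeasurableSpace (Gqs L v ⧸ Subgroup.center (Gqs L v)) := fun _ => borel _
    ∃ (Δ : ∀ v : HeightOneSpectrum (𝓞 ↥(maximalRealSubfield L)), LocalTransferFactor L H v)
      (mH : ∀ v : HeightOneSpectrum (𝓞 ↥(maximalRealSubfield L)),
    OrbitalMeasureFamily ((cmDatum L 2 (Matrix.of fun i j : Fin 2 => if i.val + j.val + 1 = 2 then (1 : L) else 0)).Local v ×
      (cmDatum L 1 (Matrix.of fun i j : Fin 1 => if i.val + j.val + 1 = 1 then (1 : L) else 0)).Local v))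
      (mG : ∀ v : HeightOneSpectrum (𝓞 ↥(maximalRealSubfield L)), OrbitalMeasureFamily ((cmDatum L 3 H).Local v))
      (νG : ∀ v : HeightOneSpectrum (𝓞 ↥(maximalRealSubfield L)), Measure ((cmDatum L 3 H).Local v))
      (νH : ∀ v : HeightOneSpectrum (𝓞 ↥(maximalRealSubfield L)),
    Measure ((cmDatum L 2 (Matrix.of fun i j : Fin 2 => if i.val + j.val + 1 = 2 then (1 : L) else 0)).Local v ×
      (cmDatum L 1 (Matrix.of fun i j : Fin 1 => if i.val + j.val + 1 = 1 then (1 : L) else 0)).Local v))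
      (μZ : ∀ v : HeightOneSpectrum (𝓞 ↥(maximalRealSubfield L)), Measure (Gqs L v ⧸ Subgroup.center (Gqs L v))),
      -- (H₄ᵀˢ) SHAPE of the kit family's finite packets at non-split places, the identity (13.1.4) for `⟨πⁿ ∘ e, some πˢ⟩` ON TEST FUNCTIONS **SIGNED** by the clause sign
      -- `ε_v(a)` of the SHAPE's own frame multiplier `a` (the node's local form-congruence binder `T` is spelled `Tv` here, the frame's `T : GL (Fin 3) ℂ` being in scope)
      (∀ (ξ : OneDimAutRepH L) (v : HeightOneSpectrum (𝓞 ↥(maximalRealSubfield L))),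
          (∀ w : PlacesOver L v, IsCMField.complexConj L • w.1 = w.1) →
          ∃ (Tv : GL (Fin 3) (LocalRing L v)) (a : LocalRing L v) (ha : IsUnit a)
            (h : formCongr (conjLocal L (IsCMField.complexConj L) v) Tv (H.map (algebraMap L (LocalRing L v))) =
              a • (Matrix.of fun i j : Fin 3 => if i.val + j.val + 1 = 3 then (1 : L) else 0).map (algebraMap L (LocalRing L v)))
            (π2 πn : IrrClass (Gqs L v)) (πs : IrrClass ((cmDatum L 3 H).Local v)),
            KeysCaseTwoLabels L v (μω.semilocalComponent L v) (torusLocalComponent L (IsCMField.complexConj L) v ξ.η)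
                (torusLocalComponent L (IsCMField.complexConj L) v ξ.ψ) π2 πn ∧
              π2.IsSquareIntegrable (μZ v) ∧ ¬ πn.IsSquareIntegrable (μZ v) ∧ πs.IsSupercuspidal ∧
              πs ≠ IrrClass.comap (cmDatumLocalCongr L v Tv ha h).symm πn ∧
              (⟨IrrClass.comap (cmDatumLocalCongr L v Tv ha h).symm πn, some πs⟩ : CMLocalAPacket L H v).CharIdentityAtTest L H v
                (fun c f => (if ∃ z : LocalRing L v, IsUnit z ∧ a = z * conjLocal L (IsCMField.complexConj L) v z then (1 : ℂ) else -1) * c.smoothTrace (νG v) f)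
                (ξ.xiLocalChar v) (νH v) (Δ v) (mH v) (mG v) ∧
              (kitFamilyOfRecord 𝔇 L ι H T hT hdef h2 μ μω hμu hμω).packFin ξ v = ⟨IrrClass.comap (cmDatumLocalCongr L v Tv ha h).symm πn, some πs⟩) ∧
      -- (H₅) (H₆) Haar measures: `μZ v` and `νG v`
      (∀ v : HeightOneSpectrum (𝓞 ↥(maximalRealSubfield L)), (μZ v).IsHaarMeasure) ∧
      (∀ v : HeightOneSpectrum (𝓞 ↥(maximalRealSubfield L)), (νG v).IsHaarMeasure) ∧
      -- (H₇) `φ ↦ φ^H` exists on `C_c^∞` at every non-split finite place [Rogawski1990 Prop. 4.9.1 (a)], at `Δ`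
      (∀ v : HeightOneSpectrum (𝓞 ↥(maximalRealSubfield L)), (∀ w : PlacesOver L v, IsCMField.complexConj L • w.1 = w.1) →
        IsLocalDeltaTransferExists L H v (Δ v) (mH v) (mG v) Literature.NumberTheory.Rogawski1990.IsLocSmooth
          Literature.NumberTheory.Rogawski1990.IsLocSmooth) ∧
      -- (H₈ᵀˢ-W1) the SIGNED letter (D-b)ᵀˢ RESTRICTED TO THE WEIGHT-ONE AUTOMORPHIC LOCUS, BY NAME, at these data (in-house payable: LH10 ROAD W)
      (∀ {n' : ℕ} (e₁ : Fin 3 × Fin 1 ≃ Fin n') (dV : Fin 3 → L) (hdV : ∀ i, IsCMField.complexConj L (dV i) = dV i) (hdV0 : ∀ i, dV i ≠ 0) (g : GL (Fin 3) L)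
          (hg : ((g : Matrix (Fin 3) (Fin 3) L).map (cmConjRingHom L))ᵀ * H * (g : Matrix (Fin 3) (Fin 3) L) = Matrix.diagonal dV) (ξ : OneDimAutRepH L),
        Literature.NumberTheory.GelbartRogawski1991.piSCompletion_isThetaTypeAtCMTestSignedW1 L H Δ mH mG νH νG ξ μω (fun v => ξ.xiLocalChar v) e₁ dV hdV hdV0 g hg)) :
    F0P2oD7alphaMemDockStatementW1.StubD7αMemDockPerMeasureTW1 := by
  intro L _ _ _ ι H T hT hdef h2 μω hμu hμω μ _
  -- borel σ-algebras, as in the node's `letI`s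
  letI : ∀ v : HeightOneSpectrum (𝓞 ↥(maximalRealSubfield L)), MeasurableSpace ((cmDatum L 3 H).Local v) := fun _ => borel _
  letI : ∀ v : HeightOneSpectrum (𝓞 ↥(maximalRealSubfield L)),
      MeasurableSpace ((cmDatum L 2 (Matrix.of fun i j : Fin 2 => if i.val + j.val + 1 = 2 then (1 : L) else 0)).Local v ×
        (cmDatum L 1 (Matrix.of fun i j : Fin 1 => if i.val + j.val + 1 = 1 then (1 : L) else 0)).Local v) := fun _ => borel _
  letI : ∀ (v : HeightOneSpectrum (𝓞 ↥(maximalRealSubfield L)))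
      (a : ((cmDatum L 2 (Matrix.of fun i j : Fin 2 => if i.val + j.val + 1 = 2 then (1 : L) else 0)).Local v ×
        (cmDatum L 1 (Matrix.of fun i j : Fin 1 => if i.val + j.val + 1 = 1 then (1 : L) else 0)).Local v)),
      MeasurableSpace (((cmDatum L 2 (Matrix.of fun i j : Fin 2 => if i.val + j.val + 1 = 2 then (1 : L) else 0)).Local v ×
          (cmDatum L 1 (Matrix.of fun i j : Fin 1 => if i.val + j.val + 1 = 1 then (1 : L) else 0)).Local v) ⧸
        Subgroup.centralizer ({a} : Set ((cmDatum L 2 (Matrix.of fun i j : Fin 2 => if i.val + j.val + 1 = 2 then (1 : L) else 0)).Local v ×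
          (cmDatum L 1 (Matrix.of fun i j : Fin 1 => if i.val + j.val + 1 = 1 then (1 : L) else 0)).Local v))) := fun _ _ => borel _
  letI : ∀ (v : HeightOneSpectrum (𝓞 ↥(maximalRealSubfield L))) (γ : (cmDatum L 3 H).Local v),
      MeasurableSpace ((cmDatum L 3 H).Local v ⧸ Subgroup.centralizer ({γ} : Set ((cmDatum L 3 H).Local v))) := fun _ _ => borel _
  letI : ∀ v : HeightOneSpectrum (𝓞 ↥(maximalRealSubfield L)), MeasurableSpace (Gqs L v ⧸ Subgroup.center (Gqs L v)) := fun _ => borel _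
  obtain ⟨Δ, mH, mG, νG, νH, μZ, hshape, hHaar, hνG, hex, hW⟩ := hrecSW1 L ι H T hT hdef h2 μω hμu hμω μ
  have hH : (H.map (cmConjRingHom L))ᵀ = H := transpose_map_cmConjRingHom_eq_of_frame L ι H T hT
  refine ⟨fun v => (Δ v).constMul ((formSignAt L (IsCMField.complexConj L) H v : ℤ) : ℂ), mH, mG, νG, νH, fun ξ v => ξ.xiLocalChar v, μZ,
    (kitFamilyOfRecord 𝔇 L ι H T hT hdef h2 μ μω hμu hμω).packFin, hHaar, hνG, ?_, ?_, ?_⟩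
  · -- DOCKᵀ-W1 at `Δ°`: ROAD W (d) junction fed (H₇) and (H₈ᵀˢ-W1)
    intro n' e₁ dV hdV hdV0 g hg ξ
    haveI : ∀ v : HeightOneSpectrum (𝓞 ↥(maximalRealSubfield L)), BorelSpace ((cmDatum L 3 H).Local v) := fun _ => ⟨rfl⟩
    haveI : ∀ v : HeightOneSpectrum (𝓞 ↥(maximalRealSubfield L)), (νG v).IsHaarMeasure := hνG
    exact F0P2oCharIdentityCompletionUniqueTestW1.cmThetaDockingClausesTestW1_constMul_formSignAt_of_thetaWitnessSignedW1 L H hH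
      (isUnit_det_of_frame L ι H T hT) Δ mH mG νH νG ξ μω (fun v => ξ.xiLocalChar v) e₁ dV hdV hdV0 g hg hex (hW e₁ dV hdV hdV0 g hg ξ)
  · -- SHAPE at `Δ°` from the SIGNED SHAPE at `Δ` (B1 `charIdentityAtTest_constMul_iff` along `clauseSign_eq_intCast_formSignAt` at the SHAPE's own frame)
    intro ξ v hns
    obtain ⟨Tv, a, ha, h', π2, πn, πs, hK, h2sq, hnsq, hsc, hne, hCI, hpack⟩ := hshape ξ v hns
    refine ⟨Tv, a, ha, h', π2, πn, πs, hK, h2sq, hnsq, hsc, hne, ?_, hpack⟩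
    dsimp only
    rw [LocalAPacket.charIdentityAtTest_constMul_iff L H v _ (fun c f => c.smoothTrace (νG v) f) (ξ.xiLocalChar v) (νH v) (Δ v) (mH v) (mG v)
      (intCast_formSignAt_mul_self L H v), ← clauseSign_eq_intCast_formSignAt L H hH v hns Tv a ha h']
    exact hCI
  · -- MEM_μ: ★ `mem_packFin_of_rows` at the rows — the packet IS the kit family's
    intro W _ _ σ hirr hsm _hadm P hP hPσ ξ hmem v _hns c hc
    exact mem_packFin_of_rows 𝔇 h L ι H T hT hdef h2 μ μω hμu hμω W σ hirr hsm P hP hPσ ξ hmem v c hc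

end PerMeasureSW1

end Summit.HodgeConjecture.HodgeConjecture.Cruxes.H413.F0P2oD7alphaMemDockOfRowsSignedW1

end
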